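import Summits.QuantumFields.BalabanUV.T4Continuum.Spine.NE1p.DressedSmallFieldMixedDerivativeBridge

/-!
# T⁴ programme, spine estimate NE1′ (node O3b/H2) — THE `s`-INTEGRAL OF DIMOCK's `∂_S` OVER THE UNIT CUBE IS BAŁABAN's MIXED DIFFERENCE `Δ_S`:
# the fundamental theorem of calculus in the decoupling parameters, in kernel — W39.1's difference form of the decoupling expansion (`mixedDiff`,
# (2.8) AFTER the `∫₀¹ ds(Δ)`) equals the cube integral of the template lineage's derivative form (`PolydiscCauchyBounds.mixedDeriv`, (1.23) ∕
# Lemma 19 BEFORE it); hence W39.1's contour letter IS the `s`-integral of Dimock's mixed derivative — (1.23)'s displayed structure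

Cell `pub-balaban`, sub-cell `t4`, row NE1′ formalisation crew (`t4/formal/NE1p/LEAVES.md` row W⟨next⟩ — own-initiative follower of the unit's W55∕W57
under typer R-T61 (ii)), unit `b2b-balaban-t4-ne1p-formalise-leaf-08` (gen 11).  ADDITIVE — imports W55 PART 1 `Spine/NE1p/DressedSmallFieldMixedDerivativeBridge`
ONLY (→ W39.1 `DressedSmallFieldMixedLetter`: `mixedDiff`, `mixedDiff_pair`, `μS`, `wS`, `σS`, `mixedLetter_rep`, `tailSet`∕`mem_tailSet` BY NAME; the NE5
substrate `Support/B13TermContours`: the clamp `interp` (+ `interp_nonneg`∕`_le_one`∕`_eq_self`) BY NAME; the Literature module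
`Dimock2011to13/PolydiscCauchyBounds`: `mixedDeriv`, `analyticOnNhd_mixedDeriv` BY NAME; W55 PART 1: `enumS`, `basePt`, `basePt_eq_cons`,
`mixedDeriv_enumS_zero`∕`_succ_of_mem`∕`_succ_of_not_mem`, `differentiable_mixedDeriv_cons`, `analyticOnNhd_cons_section`, `analyticOnNhd_apply` BY NAME).
TWO dictionary DATA `def`s (`sS`, `cubePt`), one finiteness `instance`, theorems, 1 decided `example`; 0 `def … : Prop`, 0 cite, 0 sorry, 0 `attribute`;
nothing of W39.1 ∕ W55 ∕ the substrate ∕ the Literature module restated.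

WHY THIS FILE.  [Balaban1988RGII] p. 14 (2.8) applies «Π_{Δ⊂Z∖Z̃′₀} ∫₀¹ ds(Δ) ∂∕∂s(Δ)» to one analytic expression; p. 7 «we represent all derivatives by
the Cauchy formula», (1.23) «Π_{Δ⊂Y₀∖□̃⁴} ∫ ds(Δ) (1∕2πi) ∫ dσ(Δ)∕(σ(Δ) − s(Δ))² · E(…)» — LOCI of the audited manuscript, TYPE∕CONTEXT only.  The cell holds
TWO kernel presentations of this step: W39.1's DIFFERENCE `mixedDiff n S F` (what the `∫ ds ∂∕∂s` leave behind; its contour letter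
`mixedLetter_rep`) and the template lineage's DERIVATIVE `mixedDeriv l g` ([Dimock2013] §4.5, whose one-variable interpolation identity
`apply_update_one_eq` and recursive (summer) expansion are in `PolydiscCauchyBounds`); W55 bridged them POINTWISE in `s` through the contours.
This file proves the CUBE identity directly, with no contour:
* §1 the interpolation measures `sS S` (`ds|[0,1]` on an active cube, Dirac else — the `s`-marginal of W39.1's `μS`), the CLAMPED base point
  `cubePt S s = basePt S (interp ∘ s)` (the substrate's clamp keeps the integrand bounded off the cube), `cubePt_cons`, `norm_cubePt_le`,
  `continuous_interp`, `continuous_cubePt`, **`integrable_mixedDeriv_cubePt`** (Dimock's `∂_{enumS S} F` is analytic hence continuous; the clamped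
  point stays in the compact unit polydisc);
* §2 **`integral_mixedDeriv_cubePt_eq_mixedDiff`: for `F` JOINTLY ENTIRE, `∫ ∂_{enumS S} F (cubePt S s) d(⨂_j sS S j)(s) = mixedDiff n S F`** —
  induction along `Fin.cons` (Mathlib `measurePreserving_piFinSuccAbove` + `integral_prod_symm`, HEAD variable inside): on an ACTIVE head cube the
  one-variable FTC `intervalIntegral.integral_eq_sub_of_hasDerivAt` on the ENTIRE head section `z ↦ ∂_{enumS S′}(F(z ∷ ·))(p′)` (W55's
  `differentiable_mixedDeriv_cons`, restricted to the real segment by `HasDerivAt.comp_ofReal`; the clamp removed on `[0,1]` by `interp_eq_self`),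
  on an INACTIVE one `integral_dirac`; then the induction hypothesis on the two sections `F(1 ∷ ·)`, `F(0 ∷ ·)` and W39.1's recursion for `mixedDiff`;
* §3 **`mixedLetter_eq_integral_mixedDeriv`**: W39.1's contour letter `∫ wS·F∘σS d(⨂ μS S)` EQUALS `∫_{[0,1]^S} ∂_{enumS S} F` (W39.1 `mixedLetter_rep`
  BY NAME + §2) — (1.23)'s displayed structure in kernel; decided `example`: `∫_{[0,1]²} ∂₀∂₁ e^{s₀s₁} ds = e − 1` (§2 + W39.1 `mixedDiff_pair`).

HONEST FRAMING.  [folklore] analysis (Fubini on `Measure.pi` along `Fin.cons`, the one-variable fundamental theorem of calculus on a holomorphic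
section, compactness) on OUR dictionary and the template's kernel objects BY NAME; a DICTIONARY∕BRIDGE identity, not an estimate of print; `sS`∕`cubePt`
are OURS; `F` ↔ print's s(Δ)-dependent operator products ((1.10)∕(1.23)∕(2.7)∕(2.8)) is a TYPE READING; the hypothesis is JOINT analyticity on ALL of
`ℂⁿ` (`AnalyticOnNhd ℂ F univ` — the local version would follow W57's pattern and is NOT claimed here); no numeral of [Balaban1988RGII] asserted
(k2); (B1) for Bałaban's (2.14) NOT discharged; (B3) = GAPS G-ne9p2-5 UNPRINTED — NOT discharged, untouched; (B5) untouched; 0 binders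
instantiated on Bałaban's densities ∕ operators ∕ (2.14) data ∕ `d_k` ∕ minimisers ∕ backgrounds; discharges no wall item; wall v1.8 (T4-DAG v48)
does NOT move; R-t4r2-Q2 NOT met thereby; NE1′ ⇐ the named binders — NOT proved, NOT printed; spine PROVED 0∕9; count 9 unchanged.  Rung (B)+1
on ONE finite four-torus — NOT infinite volume, NOT a mass gap, NOT OS on ℝ⁴, NOT Clay.  ABSOLUTE RULE honoured: the quotations are LOCI of the
audited manuscript [Balaban1988RGII] (CMP 116 (1988) 1–22, pp. 7, 14), TYPE∕CONTEXT only, never hypothesis-free facts; [Dimock2013] enters only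
through the cite-tagged Literature module BY NAME; nothing internally minted is cited; [folklore] tags on kernel lemmas only.  HONEST DEPENDENCY: continuum YM on T⁴ ⇐ BetaPertH ∧ nine spine estimates (0/9 proved); BetaPertH ⇐ (D1) ∧ (D4) ∧
CAP+tail; G-an2-4 gates asym, D1 and NE2/3/4.
-/

noncomputable section

namespace Summit.QuantumFields.BalabanUV.T4Continuum.NE1p.DressedSmallFieldMixedDerivativeFTC

open MeasureTheory Metric Set Complex Finset Function
open scoped BigOperators
open Summit.QuantumFields.BalabanUV.T4Continuum.B13TermContours (interp interp_nonneg interp_le_one interp_eq_self measurable_interp)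
open Summit.QuantumFields.BalabanUV.T4Continuum.NE1p.DressedSmallFieldMixedLetter
open Summit.QuantumFields.BalabanUV.T4Continuum.NE1p.DressedSmallFieldMixedDerivativeBridge
open Literature.MathematicalPhysics.QuantumFieldTheory.Dimock2011to13.PolydiscCauchyBounds (mixedDeriv analyticOnNhd_mixedDeriv)

variable {n : ℕ}

/-! ## §1 The interpolation cube: Lebesgue `ds|[0,1]` on an active cube, a Dirac filler on an inactive one; the clamped base point -/

/-- THE INTERPOLATION-PARAMETER MEASURE PER CUBE: `ds|[0,1]` on an active cube (print's «∫₀¹ ds(Δ)»), a Dirac filler on an inactive one —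
the `s`-marginal of W39.1's `μS` (whose active coordinates carry `lam₁ = ds|[0,1] ⊗ dθ|[0,2π]`). -/
def sS (S : Finset (Fin n)) (j : Fin n) : Measure ℝ :=
  if j ∈ S then volume.restrict (Icc (0 : ℝ) 1) else Measure.dirac 0

/-- [folklore] Every interpolation coordinate measure is finite. -/
instance isFiniteMeasure_sS (S : Finset (Fin n)) (j : Fin n) : IsFiniteMeasure (sS S j) := by
  unfold sS; split_ifs
  · exact isFiniteMeasure_restrict.2 measure_Icc_lt_top.ne
  · infer_instance

/-- [folklore] Tail of the interpolation measures along `Fin.succ`. -/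
theorem sS_succ (S : Finset (Fin (n + 1))) (j : Fin n) : sS S j.succ = sS (tailSet S) j := by
  simp only [sS, mem_tailSet]

/-- The CLAMPED base point: `interp (s_j) ∈ [0,1]` on an active cube (the substrate's clamp `interp`, the identity on `[0,1]` — it keeps the
integrand bounded off the cube, where the measure does not look), `0` on an inactive one. -/
def cubePt (S : Finset (Fin n)) (s : Fin n → ℝ) : Fin n → ℂ := basePt S fun j => interp (s j)

/-- [folklore] The clamped base point along `Fin.cons`. -/
theorem cubePt_cons (S : Finset (Fin (n + 1))) (x : ℝ) (z : Fin n → ℝ) :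
    cubePt S (Fin.cons x z) = Fin.cons (if (0 : Fin (n + 1)) ∈ S then ((interp x : ℝ) : ℂ) else 0) (cubePt (tailSet S) z) := by
  unfold cubePt
  rw [basePt_eq_cons]
  congr 1

/-- [folklore] The clamped base point lies in the closed unit polydisc. -/
theorem norm_cubePt_le (S : Finset (Fin n)) (s : Fin n → ℝ) (j : Fin n) : ‖cubePt S s j‖ ≤ 1 := by
  unfold cubePt basePt
  split_ifs
  · rw [Complex.norm_real, Real.norm_of_nonneg (interp_nonneg _)]; exact interp_le_one _
  · simp

/-- [folklore] The clamp is continuous. -/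
theorem continuous_interp : Continuous interp := by
  have h : interp = fun t : ℝ => max 0 (min 1 t) := rfl
  rw [h]
  exact continuous_const.max (continuous_const.min continuous_id)

/-- [folklore] The clamped base point is continuous in `s`. -/
theorem continuous_cubePt (S : Finset (Fin n)) : Continuous (cubePt S) := by
  refine continuous_pi fun j => ?_
  unfold cubePt basePt
  split_ifs
  · exact Complex.continuous_ofReal.comp (continuous_interp.comp (continuous_apply j))
  · exact continuous_const

/-- [folklore] **THE INTEGRAND IS INTEGRABLE**: for `F` jointly entire, `s ↦ ∂_{enumS S} F (cubePt S s)` is continuous and bounded (the clamped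
point stays in the compact unit polydisc; Dimock's `∂_{enumS S} F` is analytic, hence continuous), so integrable for the finite cube measure. -/
theorem integrable_mixedDeriv_cubePt (S : Finset (Fin n)) {F : (Fin n → ℂ) → ℂ} (hF : AnalyticOnNhd ℂ F univ) :
    Integrable (fun s => mixedDeriv (enumS n S) F (cubePt S s)) (Measure.pi (sS S)) := by
  have hA := analyticOnNhd_mixedDeriv isOpen_univ hF (enumS n S)
  have hc : Continuous (mixedDeriv (enumS n S) F) := continuousOn_univ.1 hA.continuousOn
  have hG : Continuous fun s => mixedDeriv (enumS n S) F (cubePt S s) := hc.comp (continuous_cubePt S)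
  obtain ⟨B, hB⟩ := (isCompact_closedBall (0 : Fin n → ℂ) 1).exists_bound_of_continuousOn hc.continuousOn
  refine Integrable.mono' (integrable_const B) hG.measurable.aestronglyMeasurable (Filter.Eventually.of_forall fun s => hB _ ?_)
  exact mem_closedBall_zero_iff.2 ((pi_norm_le_iff_of_nonneg zero_le_one).2 fun j => norm_cubePt_le S s j)

/-! ## §2 THE `s`-INTEGRAL OF DIMOCK's `∂_S` OVER THE UNIT CUBE IS W39.1's MIXED DIFFERENCE `Δ_S` -/

/-- **THE FUNDAMENTAL THEOREM OF CALCULUS IN THE DECOUPLING PARAMETERS** (kernel; induction along `Fin.cons`: Mathlib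
`measurePreserving_piFinSuccAbove` + `integral_prod_symm` (head variable INSIDE), the one-variable FTC `intervalIntegral.integral_eq_sub_of_hasDerivAt`
on the ENTIRE head section `z ↦ ∂_{enumS S′}(F(z ∷ ·))(p′)` (W55's `differentiable_mixedDeriv_cons`, restricted to the real segment by
`HasDerivAt.comp_ofReal`), `integral_dirac` on an inactive cube, W55's unfoldings `mixedDeriv_enumS_succ_of_mem`∕`_of_not_mem`): for `F` JOINTLY ENTIRE,
`∫_{[0,1]^S} ∂_{enumS S} F (s on S, 0 off S) ds = Δ_S F` — Bałaban's DIFFERENCE form of the decoupling expansion (W39.1 `mixedDiff`, (2.8)'s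
«Π_{Δ} ∫₀¹ ds(Δ) ∂∕∂s(Δ)» AFTER the `s`-integrations) IS the `s`-integral of Dimock's DERIVATIVE form (`PolydiscCauchyBounds.mixedDeriv`,
(1.23)∕Lemma 19 BEFORE them).  No contour appears: W39.1's `mixedLetter_rep` (contours ⇒ `Δ_S`) and W55's `mixedDerivLetter_rep` (contours at
fixed `s` ⇒ `∂_S`) are thereby CONSISTENT. [folklore] -/
theorem integral_mixedDeriv_cubePt_eq_mixedDiff : ∀ (n : ℕ) (S : Finset (Fin n)) (F : (Fin n → ℂ) → ℂ), AnalyticOnNhd ℂ F univ →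
    ∫ s, mixedDeriv (enumS n S) F (cubePt S s) ∂(Measure.pi (sS S)) = mixedDiff n S F
  | 0, S, F, _ => by
      rw [Measure.pi_of_empty (sS S), integral_dirac]
      unfold cubePt
      rw [mixedDeriv_enumS_zero]
      rfl
  | n + 1, S, F, hF => by
      set G : (Fin (n + 1) → ℝ) → ℂ := fun s => mixedDeriv (enumS (n + 1) S) F (cubePt S s) with hG
      have hGi : Integrable G (Measure.pi (sS S)) := integrable_mixedDeriv_cubePt S hF
      -- Fubini along `Fin.cons`, the HEAD variable integrated FIRST (inside)
      have hmp := (measurePreserving_piFinSuccAbove (sS S) 0).symm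
      have hpi : (fun j : Fin n => sS S (Fin.succAbove 0 j)) = sS (tailSet S) := by
        funext j; rw [Fin.succAbove_zero]; exact sS_succ S j
      rw [hpi] at hmp
      have he : ∀ q : ℝ × (Fin n → ℝ),
          (MeasurableEquiv.piFinSuccAbove (fun _ : Fin (n + 1) => ℝ) 0).symm q = Fin.cons q.1 q.2 := by
        intro q
        simp only [MeasurableEquiv.piFinSuccAbove_symm_apply, Fin.insertNthEquiv, Fin.insertNth_zero, Equiv.coe_fn_mk]
        rfl
      have h1 : ∫ s, G s ∂(Measure.pi (sS S)) = ∫ q, G (Fin.cons q.1 q.2) ∂((sS S 0).prod (Measure.pi (sS (tailSet S)))) := by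
        rw [← hmp.integral_comp']
        exact integral_congr_ae (Filter.Eventually.of_forall fun q => by dsimp only; rw [he])
      have hint : Integrable (fun q : ℝ × (Fin n → ℝ) => G (Fin.cons q.1 q.2)) ((sS S 0).prod (Measure.pi (sS (tailSet S)))) :=
        ((hmp.integrable_comp hGi.aestronglyMeasurable).2 hGi).congr
          (Filter.Eventually.of_forall fun q => by simp only [Function.comp_apply, he])
      rw [h1, integral_prod_symm _ hint]
      dsimp only
      -- the two sections and their induction hypotheses
      have hsec : ∀ c : ℂ, AnalyticOnNhd ℂ (fun w : Fin n → ℂ => F (Fin.cons c w)) univ := fun c => analyticOnNhd_cons_section hF c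
      have IH : ∀ c : ℂ, ∫ z, mixedDeriv (enumS n (tailSet S)) (fun w => F (Fin.cons c w)) (cubePt (tailSet S) z)
          ∂(Measure.pi (sS (tailSet S))) = mixedDiff n (tailSet S) (fun w => F (Fin.cons c w)) :=
        fun c => integral_mixedDeriv_cubePt_eq_mixedDiff n (tailSet S) _ (hsec c)
      by_cases h0 : (0 : Fin (n + 1)) ∈ S
      · -- ACTIVE head cube: the inner integral is `∫₀¹ (d∕dx) M_z(x) dx = M_z(1) − M_z(0)` by the one-variable FTC
        have hμ0 : sS S 0 = volume.restrict (Icc (0 : ℝ) 1) := if_pos h0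
        have hinner : ∀ z : Fin n → ℝ, ∫ x, G (Fin.cons x z) ∂(sS S 0) =
            mixedDeriv (enumS n (tailSet S)) (fun w => F (Fin.cons 1 w)) (cubePt (tailSet S) z) -
              mixedDeriv (enumS n (tailSet S)) (fun w => F (Fin.cons 0 w)) (cubePt (tailSet S) z) := by
          intro z
          set p := cubePt (tailSet S) z with hp
          set M : ℂ → ℂ := fun w => mixedDeriv (enumS n (tailSet S)) (fun v => F (Fin.cons w v)) p with hM
          have hMd : Differentiable ℂ M := differentiable_mixedDeriv_cons hF _ _
          have hGx : ∀ x : ℝ, G (Fin.cons x z) = deriv M ((interp x : ℝ) : ℂ) := by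
            intro x
            -- W55's unfolding of Dimock's object along `Fin.cons`, at the clamped point
            have key := mixedDeriv_enumS_succ_of_mem h0 F (fun j => interp ((Fin.cons x z : Fin (n + 1) → ℝ) j))
            have ht : (Fin.tail fun j => interp ((Fin.cons x z : Fin (n + 1) → ℝ) j)) = fun j => interp (z j) := by
              funext j; simp [Fin.tail]
            rw [ht] at key
            simp only [Fin.cons_zero] at key
            simpa [hG, hM, hp, cubePt] using key
          rw [hμ0]
          simp_rw [hGx]
          rw [integral_Icc_eq_integral_Ioc, ← intervalIntegral.integral_of_le zero_le_one]
          have hcongr : ∫ x in (0 : ℝ)..1, deriv M ((interp x : ℝ) : ℂ) = ∫ x in (0 : ℝ)..1, deriv M (x : ℂ) := by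
            refine intervalIntegral.integral_congr fun x hx => ?_
            rw [Set.uIcc_of_le zero_le_one] at hx
            simp only [interp_eq_self hx.1 hx.2]
          rw [hcongr]
          have hderiv : ∀ x ∈ uIcc (0 : ℝ) 1, HasDerivAt (fun t : ℝ => M t) (deriv M x) x := fun x _ =>
            (hMd x).hasDerivAt.comp_ofReal
          have hcont : ContinuousOn (fun t : ℝ => deriv M t) (uIcc (0 : ℝ) 1) :=
            (hMd.contDiff.continuous_deriv le_top).continuousOn.comp Complex.continuous_ofReal.continuousOn (fun _ _ => mem_univ _)
          rw [intervalIntegral.integral_eq_sub_of_hasDerivAt hderiv hcont.intervalIntegrable]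
          simp [hM]
        simp_rw [hinner]
        rw [integral_sub ((integrable_mixedDeriv_cubePt (tailSet S) (hsec 1))) ((integrable_mixedDeriv_cubePt (tailSet S) (hsec 0))),
          IH 1, IH 0]
        simp only [mixedDiff, if_pos h0]
      · -- INACTIVE head cube: Dirac at `0`, the section at the decoupled value
        have hμ0 : sS S 0 = Measure.dirac 0 := if_neg h0
        have hinner : ∀ z : Fin n → ℝ, ∫ x, G (Fin.cons x z) ∂(sS S 0) =
            mixedDeriv (enumS n (tailSet S)) (fun w => F (Fin.cons 0 w)) (cubePt (tailSet S) z) := by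
          intro z
          rw [hμ0, integral_dirac, hG]
          have key := mixedDeriv_enumS_succ_of_not_mem h0 F (fun j => interp ((Fin.cons (0 : ℝ) z : Fin (n + 1) → ℝ) j))
          have ht : (Fin.tail fun j => interp ((Fin.cons (0 : ℝ) z : Fin (n + 1) → ℝ) j)) = fun j => interp (z j) := by
            funext j; simp [Fin.tail]
          rw [ht] at key
          simpa [cubePt] using key
        simp_rw [hinner]
        rw [IH 0]
        simp only [mixedDiff, if_neg h0]

/-! ## §3 Consequences: (1.23)'s structure «Π ∫ ds(Δ) (2πi)⁻¹∮ dσ(Δ)∕(σ(Δ)−s(Δ))²» = «Π ∫ ds(Δ) ∂∕∂s(Δ)» in kernel, and a decided check -/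

/-- **W39.1's CONTOUR LETTER IS THE `s`-INTEGRAL OF DIMOCK's MIXED DERIVATIVE** (W39.1 `mixedLetter_rep` BY NAME + §2): for radii `> 1` and `F`
jointly entire, `∫ wS·F∘σS d(⨂ μS S) = ∫_{[0,1]^S} ∂_{enumS S} F (s on S, 0 off S) ds` — the two kernel presentations of the decoupling
expansion's term (Bałaban's contours, Dimock's derivatives) give the same number. [folklore] -/
theorem mixedLetter_eq_integral_mixedDeriv (r : Fin n → ℝ) (hr : ∀ j, 1 < r j) (S : Finset (Fin n)) (F : (Fin n → ℂ) → ℂ)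
    (hF : AnalyticOnNhd ℂ F univ) :
    ∫ p, wS r S p * F (σS r S p) ∂(Measure.pi (μS S)) = ∫ s, mixedDeriv (enumS n S) F (cubePt S s) ∂(Measure.pi (sS S)) := by
  rw [integral_mixedDeriv_cubePt_eq_mixedDiff n S F hF,
    mixedLetter_rep n r S F hr fun z => (hF z (mem_univ _)).differentiableAt]

/-- DECIDED CHECK (two active cubes, the NON-product entire factor `exp(z₀z₁)`): `∫_{[0,1]²} ∂₀∂₁ e^{s₀s₁} ds = e − 1 − (1 − 1) = e − 1`
(§2 + W39.1's two-cube face `mixedDiff_pair`). -/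
example : ∫ s, mixedDeriv (enumS 2 {0, 1}) (fun z : Fin 2 → ℂ => Complex.exp (z 0 * z 1)) (cubePt {0, 1} s) ∂(Measure.pi (sS {0, 1})) =
    Complex.exp 1 - 1 := by
  rw [integral_mixedDeriv_cubePt_eq_mixedDiff 2 {0, 1} _ (((analyticOnNhd_apply 0).mul (analyticOnNhd_apply 1)).cexp), mixedDiff_pair]
  simp

end Summit.QuantumFields.BalabanUV.T4Continuum.NE1p.DressedSmallFieldMixedDerivativeFTC

end
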